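import Summits.BirchSwinnertonDyer.BirchSwinnertonDyer.Theorems.AlignedTransportAtTwoBSDOfMainConjectureRankOneAtTwoEulerCharAtTwoKerGEmbedding
import Literature.GroupTheory.FiniteAbelian.HomCounts
import HarnessLib

/-!
# Route `AlignedTransportAtTwo`, crux C3′ `BSDOfMainConjectureRankOneAtTwo` (stmt-BirchSwinnertonDyer-23008), line `birth`,
# the (L) road of the kernel index: the FINITE BILINEAR COUNT `#X = #X⁰ · #(Y/Y⁰)` and the resulting identity
# `#(A₀/Sel₀) · [E(K) : E_𝒦] = ∏_{v∈S} #𝒦_{v,0}[p^∞]` MODULO the identification of the image of Greenberg's embedding with the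
# point-orthogonal classes

HONEST FRAMING (cell `bsd-f1-sign2`, attach seat `bsd-line-att-p3` g11 under the C3′ lead lineage `bsd-line-att-p1`;
`--supports stmt-BirchSwinnertonDyer-23008 --as helper`). BSD is NOT proved; C3′ is NOT closed; nothing is asserted. THEOREMS
ONLY (no `def`, no named fact, no `sorry`). Step (c) of `Cruxes/BSDOfMainConjectureRankOneAtTwo/KERINDEX-L-ROAD-att-p3-g10.md` §3.

* §1 (pure algebra) `finite_and_natCard_quotient_flip_ker_le`, `natCard_eq_natCard_ker_mul_natCard_quotient_flip_ker` — for a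
  bi-additive `B : X →+ Y →+ ℤ/n` with `X` finite: `Y/Y⁰` is finite and **`#X = #X⁰ · #(Y/Y⁰)`**, where `X⁰ = ker B` (the `x` with
  `B x = 0`) and `Y⁰ = ker B.flip` (the `y` orthogonal to all of `X`): both `X/X⁰ ↪ Hom(Y/Y⁰, ℤ/n)` and `Y/Y⁰ ↪ Hom(X/X⁰, ℤ/n)`, and
  `#Hom(G, ℤ/n) = #G[n] ≤ #G` (tree `Literature.GroupTheory.FiniteAbelian.natCard_addMonoidHom_zmod_right`).
* §2 `natCard_kerG_zero_mul_natCard_quotient_eq_prod_of_ker_eq` (+ `_of_good`) — **the (L) identity modulo the image statement**: for every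
  number field, prime, `ℤ_p`-extension `κ` and finite `S` with `𝒦_{v,0}[p^∞] = 0` off `S` and finite on `S`, and ANY bi-additive
  `B : ∏_{v∈S} 𝒦_{v,0}[p^∞] →+ (E(K) →+ ℤ/n)` whose kernel is exactly the image of the embedding `Ψ : A₀/Sel₀ ↪ ∏_{v∈S} 𝒦_{v,0}[p^∞]`
  (`…KerGEmbedding.exists_kerG_zero_embedding`): **`#(A₀/Sel₀) · #(E(K)/E_𝒦) = ∏_{v∈S} #𝒦_{v,0}[p^∞]`** with `E_𝒦 = ker B.flip` the
  points orthogonal to every local class. The intended `B` is the point obstruction `x ↦ (P ↦ ∑_{v∈∞∪S} inv_v(t(x)_v ∪ₑ loc_v κ(P)))`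
  of the sibling files `…KerGCassels` / `…KerGImage` (which give `ker B ⊆ im Ψ` and the reciprocity half of `im Ψ ⊆ ker B`); its
  descent to a bi-additive map on `∏ 𝒦_{v,0}[p^∞]` (independence of the Kummer lift, by isotropy) and the level-`p^k` lift of a
  class of `A₀` with archimedean vanishing are NOT done here.

References: [GreenbergLNM1716] §4 p. 104, Lemma 4.7 (pp. 107–108), Prop. 4.13; [MilneADT2006] I §6 Lemma 6.15, Thm. 6.13;
[Hungerford1974] IV §4 Thm. 4.7.
bears_on: stmt-BirchSwinnertonDyer-23008 (helper; closes nothing), stmt-BirchSwinnertonDyer-22298 (attach seat's item; untouched).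
-/

set_option autoImplicit false
-- the Theorems namespace of this sub repeats the summit name by design (D-0017 nested layout)
set_option linter.dupNamespace false

noncomputable section

open scoped Classical NumberField

open NumberField IsDedekindDomain Field

namespace Summit.BirchSwinnertonDyer.BirchSwinnertonDyer.Theorems.AlignedTransportAtTwoEulerCharAtTwoKerGCount

/-! ## §1 The finite bilinear count -/

section Bilinear

variable {X Y : Type*} [AddCommGroup X] [AddCommGroup Y] {n : ℕ} [NeZero n]

/-- **`Y/Y⁰ ↪ Hom(X/X⁰, ℤ/n)`**: for a bi-additive `B : X →+ Y →+ ℤ/n` with `X/ker B` finite, the quotient of `Y` by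
`Y⁰ = ker B.flip = {y : B x y = 0 ∀ x}` is finite and `#(Y/Y⁰) ≤ #(X/ker B)` (it embeds in `Hom(X/ker B, ℤ/n)`, of order
`#(X/ker B)[n] ≤ #(X/ker B)`). [cite: MilneADT2006, Ch. I §6, Lemma 6.15 (finite bilinear algebra)] [cite: Hungerford1974, Ch. IV §4 Thm. 4.7] -/
theorem finite_and_natCard_quotient_flip_ker_le (B : X →+ Y →+ ZMod n) [Finite (X ⧸ B.ker)] :
    Finite (Y ⧸ B.flip.ker) ∧ Nat.card (Y ⧸ B.flip.ker) ≤ Nat.card (X ⧸ B.ker) := by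
  -- `B.flip y` kills `ker B`
  have hdesc : ∀ y : Y, B.ker ≤ (B.flip y).ker := fun y x hx ↦ by
    rw [AddMonoidHom.mem_ker, AddMonoidHom.flip_apply, (AddMonoidHom.mem_ker).mp hx, AddMonoidHom.zero_apply]
  -- `f : Y →+ Hom(X/ker B, ℤ/n)`
  let f : Y →+ (X ⧸ B.ker →+ ZMod n) :=
    { toFun := fun y ↦ QuotientAddGroup.lift B.ker (B.flip y) (hdesc y)
      map_zero' := AddMonoidHom.ext fun q ↦ QuotientAddGroup.induction_on q fun x ↦ by
        rw [QuotientAddGroup.lift_mk, map_zero, AddMonoidHom.zero_apply, AddMonoidHom.zero_apply]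
      map_add' := fun y y' ↦ AddMonoidHom.ext fun q ↦ QuotientAddGroup.induction_on q fun x ↦ by
        rw [QuotientAddGroup.lift_mk, AddMonoidHom.add_apply, QuotientAddGroup.lift_mk, QuotientAddGroup.lift_mk,
          map_add, AddMonoidHom.add_apply] }
  have hf : ∀ (y : Y) (x : X), f y (x : X ⧸ B.ker) = B x y := fun y x ↦ by
    change QuotientAddGroup.lift B.ker (B.flip y) (hdesc y) (x : X ⧸ B.ker) = B x y
    rw [QuotientAddGroup.lift_mk, AddMonoidHom.flip_apply]
  -- `ker f = Y⁰`
  have hker : ∀ y : Y, f y = 0 ↔ y ∈ B.flip.ker := fun y ↦ by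
    rw [AddMonoidHom.mem_ker]
    constructor
    · intro h
      ext x
      rw [AddMonoidHom.flip_apply, ← hf y x, h, AddMonoidHom.zero_apply, AddMonoidHom.zero_apply]
    · intro h
      refine AddMonoidHom.ext fun q ↦ QuotientAddGroup.induction_on q fun x ↦ ?_
      rw [hf y x, AddMonoidHom.zero_apply]
      have h' := DFunLike.congr_fun h x
      rwa [AddMonoidHom.flip_apply, AddMonoidHom.zero_apply] at h'
  -- the injection `Y/Y⁰ ↪ Hom(X/ker B, ℤ/n)`
  let g : Y ⧸ B.flip.ker →+ (X ⧸ B.ker →+ ZMod n) :=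
    QuotientAddGroup.lift B.flip.ker f fun y hy ↦ (AddMonoidHom.mem_ker).mpr ((hker y).mpr hy)
  have hg : Function.Injective g := by
    refine (injective_iff_map_eq_zero g).mpr fun q hq ↦ ?_
    induction q using QuotientAddGroup.induction_on with
    | H y =>
      rw [QuotientAddGroup.lift_mk] at hq
      exact (QuotientAddGroup.eq_zero_iff y).mpr ((hker y).mp hq)
  haveI : Finite (X ⧸ B.ker →+ ZMod n) :=
    Finite.of_injective (fun φ : X ⧸ B.ker →+ ZMod n ↦ (φ : X ⧸ B.ker → ZMod n)) DFunLike.coe_injective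
  haveI : Finite (Y ⧸ B.flip.ker) := Finite.of_injective g hg
  refine ⟨inferInstance, ?_⟩
  calc Nat.card (Y ⧸ B.flip.ker) ≤ Nat.card (X ⧸ B.ker →+ ZMod n) := Nat.card_le_card_of_injective g hg
    _ = Nat.card (AddSubgroup.torsionBy (X ⧸ B.ker) n) :=
        Literature.GroupTheory.FiniteAbelian.natCard_addMonoidHom_zmod_right (X ⧸ B.ker) n
    _ ≤ Nat.card (X ⧸ B.ker) := AddSubgroup.card_le_card_addGroup _

/-- **THE FINITE BILINEAR COUNT `#X = #X⁰ · #(Y/Y⁰)`.** For a bi-additive `B : X →+ Y →+ ℤ/n` with `X` finite: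
`#X = #(ker B) · #(Y/ker B.flip)` (and `Y/ker B.flip` is finite): `X/X⁰` and `Y/Y⁰` embed in each other's `ℤ/n`-duals, so
they have the same order. This is the counting step of Cassels–Poitou–Tate: `#(∏_v 𝒦_v) = #(im of the global classes) ·
[E(K) : E_𝒦]`. [cite: MilneADT2006, Ch. I §6, Lemma 6.15 and Thm. 6.13 (finite bilinear algebra)] [cite: GreenbergLNM1716, §4 Lemma 4.7 (pp. 107–108)] -/
theorem natCard_eq_natCard_ker_mul_natCard_quotient_flip_ker [Finite X] (B : X →+ Y →+ ZMod n) :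
    Finite (Y ⧸ B.flip.ker) ∧ Nat.card X = Nat.card B.ker * Nat.card (Y ⧸ B.flip.ker) := by
  obtain ⟨hfinY, hle₁⟩ := finite_and_natCard_quotient_flip_ker_le B
  haveI := hfinY
  obtain ⟨-, hle₂⟩ := finite_and_natCard_quotient_flip_ker_le B.flip
  have hflip : B.flip.flip = B := AddMonoidHom.ext fun _ ↦ AddMonoidHom.ext fun _ ↦ rfl
  rw [hflip] at hle₂
  refine ⟨hfinY, ?_⟩
  rw [B.ker.card_eq_card_quotient_mul_card_addSubgroup, mul_comm, le_antisymm hle₂ hle₁]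

end Bilinear


/-! ## §2 The (L) identity modulo the image statement -/

section KerG

open Literature.NumberTheory.EllipticCurves Literature.NumberTheory.GaloisRepresentations WeierstrassCurve
open Summit.BirchSwinnertonDyer.BirchSwinnertonDyer.Theorems.AlignedTransportAtTwoEulerCharAtTwoKerGEmbedding

universe u

variable {K : Type u} [Field K] [NumberField K] (W : WeierstrassCurve K) (p : ℕ) [hp : Fact p.Prime]
  (κ : ZpExtension K p)

set_option maxHeartbeats 2000000 in -- unifying the two instance paths on `∏_{v∈S} 𝒦_{v,0}[p^∞]` (generic §1 vs this statement)
/-- **`#(A₀/Sel₀) · #(E(K)/E_𝒦) = ∏_{v∈S} #𝒦_{v,0}[p^∞]` MODULO THE IMAGE STATEMENT** (every number field, prime, `ℤ_p`-extension,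
any rank). Let `S` be finite with `𝒦_{v,0}[p^∞] = 0` off `S` and finite on `S`, and let `B : ∏_{v∈S} 𝒦_{v,0}[p^∞] →+ (E(K) →+ ℤ/n)` be
ANY bi-additive map whose kernel is exactly the set of values `(loc_v y)_{v∈S}`, `y ∈ A₀ = h₀⁻¹(Sel_{p^∞}(E/K_∞))`, of Greenberg's
embedding `A₀/Sel₀ ↪ ∏_{v∈S} 𝒦_{v,0}[p^∞]` (`exists_kerG_zero_embedding`). Then, with `E_𝒦 = ker B.flip` the points orthogonal to every
local class, `E(K)/E_𝒦` is finite and **`#(A₀/Sel₀) · #(E(K)/E_𝒦) = ∏_{v∈S} #𝒦_{v,0}[p^∞]`** (§1 with `#(A₀/Sel₀) = #ker B`). For the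
point obstruction `B` of Cassels–Poitou–Tate this is Greenberg's Lemma 4.7 in positive rank (`[E(K) : E_𝒦]` = the order of the
image of `ker r₀` in the dual of the compact Selmer group); in rank `0` (`B = 0` on a finite `Sel`) it is the tree's
`InputsGreenbergKerG.natCard_kerG_zero_eq_prod`. [cite: GreenbergLNM1716, §4 p. 104, Lemma 4.7 (pp. 107–108), Prop. 4.13 (p. 122)]
[cite: MilneADT2006, Ch. I §6, Lemma 6.15] -/
theorem natCard_kerG_zero_mul_natCard_quotient_eq_prod_of_ker_eq (S : Finset (HeightOneSpectrum (𝓞 K)))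
    (h0 : ∀ v ∉ S, W.localTowerKerPrimary κ (v.adicCompletion K) 0 = ⊥)
    (hfin : ∀ v ∈ S, Finite (W.localTowerKerPrimary κ (v.adicCompletion K) 0))
    {n : ℕ} [NeZero n]
    (B : (∀ v : S, W.localTowerKerPrimary κ (v.1.adicCompletion K) 0) →+ (W.toAffine.Point →+ ZMod n))
    (hB : ∀ x : ∀ v : S, W.localTowerKerPrimary κ (v.1.adicCompletion K) 0,
      B x = 0 ↔ ∃ y ∈ W.selmerInftyPreimage κ 0, ∀ v : S,
        W.localResOver p (κ.layerSubgroup 0) (v.1.adicCompletion K) y =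
          ((x v : W.localTowerKerPrimary κ (v.1.adicCompletion K) 0) :
            discreteH1 (localSubgroup (κ.layerSubgroup 0) (v.1.adicCompletion K)) (localPoints W (v.1.adicCompletion K)))) :
    Finite (W.toAffine.Point ⧸ B.flip.ker) ∧
      Nat.card (W.KerG κ 0) * Nat.card (W.toAffine.Point ⧸ B.flip.ker) =
        ∏ v ∈ S, Nat.card (W.localTowerKerPrimary κ (v.adicCompletion K) 0) := by
  haveI : ∀ v : S, Finite (W.localTowerKerPrimary κ (v.1.adicCompletion K) 0) := fun v ↦ hfin v.1 v.2
  obtain ⟨Ψ, hΨ, hΨval⟩ := exists_kerG_zero_embedding W p κ S h0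
  -- `range Ψ = ker B`
  have hrange : Set.range Ψ = (B.ker : Set (∀ v : S, W.localTowerKerPrimary κ (v.1.adicCompletion K) 0)) := by
    ext x
    rw [SetLike.mem_coe, AddMonoidHom.mem_ker, hB x, Set.mem_range]
    constructor
    · rintro ⟨q, rfl⟩
      induction q using QuotientAddGroup.induction_on with
      | H y => exact ⟨y, y.2, fun v ↦ (hΨval y v).symm⟩
    · rintro ⟨y, hy, hyx⟩
      refine ⟨((⟨y, hy⟩ : W.selmerInftyPreimage κ 0) : W.KerG κ 0), funext fun v ↦ Subtype.ext ?_⟩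
      rw [hΨval ⟨y, hy⟩ v]
      exact hyx v
  have hcard : Nat.card (W.KerG κ 0) = Nat.card B.ker := by
    rw [Nat.card_congr (Equiv.ofInjective Ψ hΨ), Nat.card_congr (Equiv.setCongr hrange)]
    rfl
  haveI hX : Finite (∀ v : S, W.localTowerKerPrimary κ (v.1.adicCompletion K) 0) := Pi.finite
  obtain ⟨hfinY, hcount⟩ := natCard_eq_natCard_ker_mul_natCard_quotient_flip_ker B
  refine ⟨hfinY, ?_⟩
  have h1 : Nat.card (∀ v : S, W.localTowerKerPrimary κ (v.1.adicCompletion K) 0) =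
      ∏ v ∈ S, Nat.card (W.localTowerKerPrimary κ (v.adicCompletion K) 0) := by
    rw [Nat.card_pi]
    exact Finset.prod_coe_sort S (fun v ↦ Nat.card (W.localTowerKerPrimary κ (v.adicCompletion K) 0))
  have h3 : Nat.card B.ker * Nat.card (W.toAffine.Point ⧸ B.flip.ker) =
      Nat.card (∀ v : S, W.localTowerKerPrimary κ (v.1.adicCompletion K) 0) := hcount.symm
  rw [hcard, h3, h1]

/-- The same under Greenberg's hypothesis `S ⊇ {v ∣ p} ∪ {bad places}` for an elliptic curve (off `S`, `𝒦_{v,0}[p^∞] = 0` is Lemma 3.3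
at a good `v ∤ p`, tree `Greenberg1999.localTowerKerPrimary_eq_bot_of_hasGoodReductionAt`). [cite: GreenbergLNM1716, §3 Lemma 3.3 (p. 87), §4 Lemma 4.7] -/
theorem natCard_kerG_zero_mul_natCard_quotient_eq_prod_of_ker_eq_of_good [W.IsElliptic] (S : Finset (HeightOneSpectrum (𝓞 K)))
    (hS : ∀ v ∉ S, ((p : ℕ) : 𝓞 K) ∉ v.asIdeal ∧ W.HasGoodReductionAt v)
    (hfin : ∀ v ∈ S, Finite (W.localTowerKerPrimary κ (v.adicCompletion K) 0))
    {n : ℕ} [NeZero n]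
    (B : (∀ v : S, W.localTowerKerPrimary κ (v.1.adicCompletion K) 0) →+ (W.toAffine.Point →+ ZMod n))
    (hB : ∀ x : ∀ v : S, W.localTowerKerPrimary κ (v.1.adicCompletion K) 0,
      B x = 0 ↔ ∃ y ∈ W.selmerInftyPreimage κ 0, ∀ v : S,
        W.localResOver p (κ.layerSubgroup 0) (v.1.adicCompletion K) y =
          ((x v : W.localTowerKerPrimary κ (v.1.adicCompletion K) 0) :
            discreteH1 (localSubgroup (κ.layerSubgroup 0) (v.1.adicCompletion K)) (localPoints W (v.1.adicCompletion K)))) :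
    Finite (W.toAffine.Point ⧸ B.flip.ker) ∧
      Nat.card (W.KerG κ 0) * Nat.card (W.toAffine.Point ⧸ B.flip.ker) =
        ∏ v ∈ S, Nat.card (W.localTowerKerPrimary κ (v.adicCompletion K) 0) :=
  natCard_kerG_zero_mul_natCard_quotient_eq_prod_of_ker_eq W p κ S
    (fun v hv ↦ Greenberg1999.localTowerKerPrimary_eq_bot_of_hasGoodReductionAt W κ (hS v hv).1 (hS v hv).2 0) hfin B hB

end KerG

end Summit.BirchSwinnertonDyer.BirchSwinnertonDyer.Theorems.AlignedTransportAtTwoEulerCharAtTwoKerGCount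

end
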